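import Literature.MathematicalPhysics.QuantumChemistry.TempleThirringBounds
import Literature.MathematicalPhysics.QuantumChemistry.SectorEnergyPerturbationBounds
import Literature.LinearAlgebra.Matrix.PosSemidefBlockCauchySchwarz
import HarnessLib

/-!
# Thirring's rank-one bound and two-sided perturbation bound, and Temple's inequality: PROOFS
# (discharging the named facts `thirringRankOneBound`, `thirringPerturbationSandwich` and
# `templeInequality` of `TempleThirringBounds.lean`)

Topic `MathematicalPhysics/QuantumChemistry`. Three discharges, no new statement:

* `thirringRankOneBound_holds` — Reed–Simon IV Problem XIII.13(c) in its `H₀`-free form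
  `|(ψ₀, φ)|² / (ψ₀, V⁻¹ψ₀) ≤ (φ, Vφ)` for `V ≻ 0`: this is Horn–Johnson Problem 7.7.P10
  «`(x^*Ax)(y^*A⁻¹y) ≥ |x^*y|²`» with `A := V⁻¹`, already in the tree as
  `Literature.LinearAlgebra.Matrix.norm_sq_dotProduct_le_quadForm_mul_quadForm_inv`.
* `thirringPerturbationSandwich_holds` — Reed–Simon IV, Notes to §XIII.2:
  `λ(ψ, V⁻¹ψ)⁻¹ ≤ E(λ) − E(0) ≤ λ(ψ, Vψ)` for `λ(ψ, V⁻¹ψ)⁻¹ ≤ d`, in a sector `K`. Lower side: for a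
  unit `φ ∈ K` write `φ = aψ + φ′` with `a = (ψ, φ)`, `φ′ ⊥ ψ`; then
  `Re(φ, H₀φ) = |a|²e₀ + Re(φ′, H₀φ′) ≥ |a|²e₀ + (e₀ + d)(1 − |a|²)` (eigenvector + gap hypothesis) and
  `Re(φ, Vφ) ≥ |a|²/(ψ, V⁻¹ψ)` (the rank-one bound), so
  `Re(φ, (H₀ + λV)φ) ≥ e₀ + d(1 − |a|²) + λ|a|²/(ψ, V⁻¹ψ) ≥ e₀ + λ/(ψ, V⁻¹ψ)`; take the infimum over
  `φ` (`le_minEnergyOn_of_forall_re_rayleigh`). Upper side: Rayleigh–Ritz with `ψ` itself.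
* `templeInequality_holds` — Reed–Simon IV Thm XIII.5 (p. 84), the printed proof «the operator
  inequality `(H − μ₁)(H − μ̌₂) ≥ 0`» carried out in the sector `K`: with `μ₁ = minEnergyOn H K` put
  `B = H² − (μ₁ + μ̌₂)H` (Hermitian, `K`-invariant, commuting with `H`); the sector energy `β` of `B`
  is attained on the multiplet `K ∩ ker(B − β)` (`exists_unit_eigen_minEnergyOn`), which is
  `H`-invariant, so it contains a unit `H`-eigenvector `u`, `Hu = λu`, whence `β = λ² − (μ₁ + μ̌₂)λ`;
  `λ ≥ μ₁` (variational principle) and `λ ≠ μ₁ ⇒ λ ≥ μ̌₂` (the hypothesis), so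
  `β + μ₁μ̌₂ = (λ − μ₁)(λ − μ̌₂) ≥ 0`; the variational principle for `B` at the trial state `ψ` gives
  `(ψ, H²ψ) − (μ₁ + μ̌₂)(ψ, Hψ) + μ₁μ̌₂ ≥ 0`, which rearranges (using `(ψ, Hψ) < μ̌₂`) to Temple's bound.

References: M. Reed, B. Simon, *Methods of Modern Mathematical Physics IV* (1978), Thm XIII.5
(p. 84) [cite: ReedSimonIV1978, Thm XIII.5], Problem XIII.13,
Notes to §XIII.2 [cite: ReedSimonIV1978, Problem XIII.13(c)]; R. A. Horn, C. R. Johnson, *Matrix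
Analysis* 2nd ed. (2013), Problem 7.7.P10 [cite: HornJohnson2013, Problem 7.7.P10].
-/

noncomputable section

namespace Literature.MathematicalPhysics.QuantumChemistry

open Matrix
open Literature.MathematicalPhysics.QuantumLattice
open scoped ComplexOrder ComplexConjugate

variable {n : Type*} [Fintype n] [DecidableEq n]

/-- **Thirring's rank-one form bound holds** (Reed–Simon IV Problem XIII.13(c); = Horn–Johnson
7.7.P10 with `A := V⁻¹`): for `V ≻ 0`, `ψ₀ ≠ 0` and every `φ`,
`|(ψ₀, φ)|² / Re(ψ₀, V⁻¹ψ₀) ≤ Re(φ, Vφ)`. Discharges `thirringRankOneBound`.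
[cite: ReedSimonIV1978, Problem XIII.13(c)] -/
theorem thirringRankOneBound_holds : thirringRankOneBound (n := n) := by
  intro V hV ψ₀ φ hψ₀
  have hdet : IsUnit V.det := (Matrix.isUnit_iff_isUnit_det V).mp hV.isUnit
  have h := Literature.LinearAlgebra.Matrix.norm_sq_dotProduct_le_quadForm_mul_quadForm_inv hV.inv ψ₀ φ
  rw [Matrix.nonsing_inv_nonsing_inv V hdet] at h
  simp only [RCLike.re_to_complex] at h
  have hpos : 0 < (star ψ₀ ⬝ᵥ V⁻¹ *ᵥ ψ₀).re :=
    (Complex.pos_iff.mp (hV.inv.dotProduct_mulVec_pos hψ₀)).1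
  rw [div_le_iff₀ hpos, mul_comm]
  exact h

omit [DecidableEq n] in
/-- The Rayleigh quotient of `H₀ + λV` splits: `Re(φ, (H₀ + λV)φ) = Re(φ, H₀φ) + λ·Re(φ, Vφ)` for
real `λ`. [cite: ReedSimonIV1978, Notes to §XIII.2 (Thirring's bounds)] -/
private theorem re_rayleigh_add_real_smul' (H₀ V : Matrix n n ℂ) (lam : ℝ) (φ : n → ℂ) :
    (star φ ⬝ᵥ (H₀ + (lam : ℂ) • V) *ᵥ φ).re =
      (star φ ⬝ᵥ H₀ *ᵥ φ).re + lam * (star φ ⬝ᵥ V *ᵥ φ).re := by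
  rw [add_mulVec, smul_mulVec, dotProduct_add, dotProduct_smul, Complex.add_re, smul_eq_mul,
    Complex.re_ofReal_mul]

omit [DecidableEq n] in
/-- Norm of the component orthogonal to a unit vector: for `(ψ, ψ) = 1`, `a = (ψ, φ)` and
`(φ, φ) = 1`, `(φ − aψ, φ − aψ) = 1 − a·ā`. [cite: ReedSimonIV1978, Notes to §XIII.2 (Thirring's bounds)] -/
private theorem star_sub_smul_dotProduct_self {ψ φ : n → ℂ} (hψ1 : star ψ ⬝ᵥ ψ = 1)
    (hφ1 : star φ ⬝ᵥ φ = 1) :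
    star (φ - (star ψ ⬝ᵥ φ) • ψ) ⬝ᵥ (φ - (star ψ ⬝ᵥ φ) • ψ) =
      1 - (star ψ ⬝ᵥ φ) * star (star ψ ⬝ᵥ φ) := by
  have hφψ : star φ ⬝ᵥ ψ = star (star ψ ⬝ᵥ φ) := by rw [star_dotProduct]
  rw [star_sub, star_smul, sub_dotProduct, dotProduct_sub, dotProduct_sub, smul_dotProduct,
    smul_dotProduct, dotProduct_smul, dotProduct_smul, hψ1, hφ1, hφψ]
  simp only [smul_eq_mul]
  ring

omit [DecidableEq n] in
/-- The `H₀`-form splits along `φ = aψ + (φ − aψ)` when `H₀ψ = e₀ψ`, `(ψ, ψ) = 1`, `a = (ψ, φ)`: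
`(φ − aψ, H₀(φ − aψ)) = (φ, H₀φ) − e₀·a·ā` (the cross terms vanish because `H₀` is Hermitian and
`φ − aψ ⊥ ψ`). [cite: ReedSimonIV1978, Notes to §XIII.2 (Thirring's bounds)] -/
private theorem star_sub_smul_dotProduct_mulVec {H₀ : Matrix n n ℂ} (hH : H₀.IsHermitian)
    {ψ φ : n → ℂ} {e₀ : ℝ} (hψ1 : star ψ ⬝ᵥ ψ = 1) (hHψ : H₀ *ᵥ ψ = (e₀ : ℂ) • ψ) :
    star (φ - (star ψ ⬝ᵥ φ) • ψ) ⬝ᵥ H₀ *ᵥ (φ - (star ψ ⬝ᵥ φ) • ψ) =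
      star φ ⬝ᵥ H₀ *ᵥ φ - (e₀ : ℂ) * ((star ψ ⬝ᵥ φ) * star (star ψ ⬝ᵥ φ)) := by
  have hφψ : star φ ⬝ᵥ ψ = star (star ψ ⬝ᵥ φ) := by rw [star_dotProduct]
  have hφHψ : star φ ⬝ᵥ H₀ *ᵥ ψ = (e₀ : ℂ) * star (star ψ ⬝ᵥ φ) := by
    rw [hHψ, dotProduct_smul, hφψ, smul_eq_mul]
  have hψHφ : star ψ ⬝ᵥ H₀ *ᵥ φ = (e₀ : ℂ) * (star ψ ⬝ᵥ φ) := by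
    rw [EigenvalueContinuation.star_dotProduct_mulVec_comm hH.eq ψ φ, hφHψ, star_mul', star_star,
      Complex.star_def, Complex.conj_ofReal]
  have hψHψ : star ψ ⬝ᵥ H₀ *ᵥ ψ = (e₀ : ℂ) := by
    rw [hHψ, dotProduct_smul, hψ1, smul_eq_mul, mul_one]
  rw [mulVec_sub, mulVec_smul, star_sub, star_smul, sub_dotProduct, dotProduct_sub, dotProduct_sub,
    smul_dotProduct, smul_dotProduct, dotProduct_smul, dotProduct_smul, hφHψ, hψHφ, hψHψ]
  simp only [smul_eq_mul]
  ring

/-- **Thirring's two-sided perturbation bound holds** (Reed–Simon IV, Notes to §XIII.2, sector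
form): `e₀ + λ/(ψ, V⁻¹ψ) ≤ E_K(H₀ + λV) ≤ e₀ + λ(ψ, Vψ)` under the hypotheses of
`thirringPerturbationSandwich` (unit eigenvector `ψ ∈ K` of `H₀` with eigenvalue `e₀`, variational gap
`d` on `K ∩ ψ^⊥`, `V ≻ 0`, `0 ≤ λ`, `λ/(ψ, V⁻¹ψ) ≤ d`). Discharges `thirringPerturbationSandwich`.
[cite: ReedSimonIV1978, Notes to §XIII.2 (Thirring's bounds)] -/
theorem thirringPerturbationSandwich_holds : thirringPerturbationSandwich (n := n) := by
  intro H₀ V hH hV K ψ e₀ d lam hψK hψ1 hHψ hgap hlam hcd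
  have hψ0 : ψ ≠ 0 := by
    rintro rfl
    simp at hψ1
  have hw : 0 < (star ψ ⬝ᵥ V⁻¹ *ᵥ ψ).re :=
    (Complex.pos_iff.mp (hV.inv.dotProduct_mulVec_pos hψ0)).1
  have hK : K ≠ ⊥ := by
    intro hbot
    rw [hbot, Submodule.mem_bot] at hψK
    exact hψ0 hψK
  have hHV : (H₀ + (lam : ℂ) • V).IsHermitian := by
    refine hH.add ?_
    rw [IsHermitian, conjTranspose_smul, hV.isHermitian.eq, Complex.star_def, Complex.conj_ofReal]
  constructor
  · -- lower side: every unit vector of `K` has Rayleigh quotient `≥ e₀ + λ/(ψ, V⁻¹ψ)`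
    refine le_minEnergyOn_of_forall_re_rayleigh _ hK fun φ hφK hφ1 => ?_
    rw [re_rayleigh_add_real_smul']
    -- the component of `φ` orthogonal to `ψ`
    have hφ'K : φ - (star ψ ⬝ᵥ φ) • ψ ∈ K := K.sub_mem hφK (K.smul_mem _ hψK)
    have horth : star ψ ⬝ᵥ (φ - (star ψ ⬝ᵥ φ) • ψ) = 0 := by
      rw [dotProduct_sub, dotProduct_smul, hψ1, smul_eq_mul, mul_one, sub_self]
    -- `t = |a|²`, `(φ', φ') = 1 − t ≥ 0`
    have haa : (star ψ ⬝ᵥ φ) * star (star ψ ⬝ᵥ φ) = ((‖star ψ ⬝ᵥ φ‖ ^ 2 : ℝ) : ℂ) := by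
      rw [Complex.star_def, Complex.mul_conj', Complex.ofReal_pow]
    have hnorm : (star (φ - (star ψ ⬝ᵥ φ) • ψ) ⬝ᵥ (φ - (star ψ ⬝ᵥ φ) • ψ)).re =
        1 - ‖star ψ ⬝ᵥ φ‖ ^ 2 := by
      rw [star_sub_smul_dotProduct_self hψ1 hφ1, haa, Complex.sub_re, Complex.one_re,
        Complex.ofReal_re]
    have ht1 : 0 ≤ 1 - ‖star ψ ⬝ᵥ φ‖ ^ 2 := by
      rw [← hnorm]
      exact (Complex.nonneg_iff.mp (dotProduct_star_self_nonneg _)).1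
    -- the `H₀` part: `Re(φ, H₀φ) = Re(φ', H₀φ') + e₀ t ≥ (e₀ + d)(1 − t) + e₀ t`
    have hH0 : (star φ ⬝ᵥ H₀ *ᵥ φ).re =
        (star (φ - (star ψ ⬝ᵥ φ) • ψ) ⬝ᵥ H₀ *ᵥ (φ - (star ψ ⬝ᵥ φ) • ψ)).re +
          e₀ * ‖star ψ ⬝ᵥ φ‖ ^ 2 := by
      rw [star_sub_smul_dotProduct_mulVec hH hψ1 hHψ, haa, ← Complex.ofReal_mul, Complex.sub_re,
        Complex.ofReal_re]
      ring
    have hg := hgap _ hφ'K horth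
    rw [hnorm] at hg
    -- the `V` part: Thirring's rank-one bound
    have hT := thirringRankOneBound_holds V hV ψ φ hψ0
    have hT' : lam * (‖star ψ ⬝ᵥ φ‖ ^ 2 / (star ψ ⬝ᵥ V⁻¹ *ᵥ ψ).re) ≤
        lam * (star φ ⬝ᵥ V *ᵥ φ).re := mul_le_mul_of_nonneg_left hT hlam
    have hcd' : lam / (star ψ ⬝ᵥ V⁻¹ *ᵥ ψ).re * (1 - ‖star ψ ⬝ᵥ φ‖ ^ 2) ≤
        d * (1 - ‖star ψ ⬝ᵥ φ‖ ^ 2) := mul_le_mul_of_nonneg_right hcd ht1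
    have key : lam / (star ψ ⬝ᵥ V⁻¹ *ᵥ ψ).re =
        lam / (star ψ ⬝ᵥ V⁻¹ *ᵥ ψ).re * (1 - ‖star ψ ⬝ᵥ φ‖ ^ 2) +
          lam * (‖star ψ ⬝ᵥ φ‖ ^ 2 / (star ψ ⬝ᵥ V⁻¹ *ᵥ ψ).re) := by
      ring
    rw [hH0]
    linarith
  · -- upper side: Rayleigh–Ritz with the trial state `ψ`
    have hle := minEnergyOn_le_rayleigh_of_mem hHV K hψK hψ1
    rw [re_rayleigh_add_real_smul', hHψ, dotProduct_smul, hψ1, smul_eq_mul, mul_one,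
      Complex.ofReal_re] at hle
    exact hle

/-! ### Temple's inequality -/

omit [DecidableEq n] in
/-- **Temple's inequality holds** (Reed–Simon IV Thm XIII.5, p. 84, finite-dimensional sector
form): for Hermitian `H`, an `H`-invariant subspace `K`, a real `μ̌₂` below every eigenvalue of `H|_K`
other than `μ₁ = minEnergyOn H K`, and a unit `ψ ∈ K` with `(ψ, Hψ) < μ̌₂`,
`(ψ, Hψ) − ((ψ, H²ψ) − (ψ, Hψ)²) / (μ̌₂ − (ψ, Hψ)) ≤ μ₁`. The printed proof («the operator inequality
`(H − μ₁)(H − μ̌₂) ≥ 0`»), realised in `K` through the variational principle for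
`B = H² − (μ₁ + μ̌₂)H` and an `H`-eigenvector inside the sector ground multiplet of `B`.
Discharges `templeInequality`. [cite: ReedSimonIV1978, Thm XIII.5] -/
theorem templeInequality_holds : templeInequality (n := n) := by
  intro H hH K hKH μ₂' hgap ψ hψK hψ1 hlt
  have hψ0 : ψ ≠ 0 := by
    rintro rfl
    simp at hψ1
  have hK : K ≠ ⊥ := by
    intro hbot
    rw [hbot, Submodule.mem_bot] at hψK
    exact hψ0 hψK
  -- the auxiliary Hermitian matrix `B = H² − (μ₁ + μ̌₂) H`; `K` is `B`-invariant, `B` commutes with `H`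
  set μ₁ : ℝ := H.minEnergyOn K with hμ₁def
  set B : Matrix n n ℂ := H * H - ((μ₁ + μ₂' : ℝ) : ℂ) • H with hBdef
  have hBH : B.IsHermitian := by
    have h2 : (H * H).IsHermitian := by
      rw [IsHermitian, conjTranspose_mul, hH.eq]
    have h1 : (((μ₁ + μ₂' : ℝ) : ℂ) • H).IsHermitian := by
      rw [IsHermitian, conjTranspose_smul, hH.eq, Complex.star_def, Complex.conj_ofReal]
    exact h2.sub h1
  have hBv : ∀ v : n → ℂ, B *ᵥ v = H *ᵥ (H *ᵥ v) - ((μ₁ + μ₂' : ℝ) : ℂ) • H *ᵥ v := by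
    intro v
    rw [hBdef, sub_mulVec, smul_mulVec, ← mulVec_mulVec]
  have hKB : ∀ v ∈ K, B *ᵥ v ∈ K := by
    intro v hv
    rw [hBv v]
    exact K.sub_mem (hKH _ (hKH v hv)) (K.smul_mem _ (hKH v hv))
  have hHB : ∀ v : n → ℂ, H *ᵥ (B *ᵥ v) = B *ᵥ (H *ᵥ v) := by
    intro v
    rw [hBv v, hBv (H *ᵥ v), mulVec_sub, mulVec_smul]
  -- the sector ground multiplet `K' = K ∩ ker (B − β)` of `B` is non-trivial and `H`-invariant
  set β : ℝ := B.minEnergyOn K with hβdef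
  set K' : Submodule ℂ (n → ℂ) := K ⊓ Module.End.eigenspace (Matrix.mulVecLin B) (β : ℂ)
    with hK'def
  have hmemK' : ∀ v : n → ℂ, v ∈ K' ↔ v ∈ K ∧ B *ᵥ v = (β : ℂ) • v := fun v => by
    rw [hK'def, Submodule.mem_inf, Module.End.mem_eigenspace_iff, Matrix.mulVecLin_apply]
  obtain ⟨w, hwK, hw1, hBw⟩ := exists_unit_eigen_minEnergyOn hBH K hKB hK
  have hw0 : w ≠ 0 := by
    rintro rfl
    simp at hw1
  have hK' : K' ≠ ⊥ := by
    rw [Submodule.ne_bot_iff]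
    exact ⟨w, (hmemK' w).2 ⟨hwK, hBw⟩, hw0⟩
  have hK'H : ∀ v ∈ K', H *ᵥ v ∈ K' := by
    intro v hv
    obtain ⟨hvK, hBβ⟩ := (hmemK' v).1 hv
    refine (hmemK' _).2 ⟨hKH v hvK, ?_⟩
    rw [← hHB v, hBβ, mulVec_smul]
  -- a unit `H`-eigenvector `u ∈ K'`: `Hu = λu`, `Bu = βu`, hence `β = λ² − (μ₁ + μ̌₂)λ`
  set lam : ℝ := H.minEnergyOn K' with hlamdef
  obtain ⟨u, huK', hu1, hHu⟩ := exists_unit_eigen_minEnergyOn hH K' hK'H hK'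
  obtain ⟨huK, hBu⟩ := (hmemK' u).1 huK'
  have hu0 : u ≠ 0 := by
    rintro rfl
    simp at hu1
  have hβeq : β = lam ^ 2 - (μ₁ + μ₂') * lam := by
    have h1 : (star u ⬝ᵥ B *ᵥ u).re = β := by
      rw [hBu, dotProduct_smul, hu1, smul_eq_mul, mul_one, Complex.ofReal_re]
    have hHHu : H *ᵥ (H *ᵥ u) = ((lam : ℂ) * (lam : ℂ)) • u := by
      rw [hHu, mulVec_smul, hHu, smul_smul]
    have h2 : (star u ⬝ᵥ B *ᵥ u).re = lam ^ 2 - (μ₁ + μ₂') * lam := by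
      rw [hBv u, hHHu, hHu, dotProduct_sub, dotProduct_smul, dotProduct_smul, dotProduct_smul, hu1]
      simp only [smul_eq_mul, mul_one, Complex.sub_re, Complex.re_ofReal_mul, Complex.ofReal_re]
      ring
    rw [← h1, h2]
  -- `λ ≥ μ₁` (variational principle in `K`) and `λ ≠ μ₁ ⇒ λ ≥ μ̌₂` (the gap hypothesis), so
  -- `β + μ₁ μ̌₂ = (λ − μ₁)(λ − μ̌₂) ≥ 0`
  have hlam1 : μ₁ ≤ lam := by
    have h := minEnergyOn_mul_le_re_rayleigh hH K huK
    rwa [hu1, Complex.one_re, mul_one, hHu, dotProduct_smul, hu1, smul_eq_mul, mul_one,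
      Complex.ofReal_re] at h
  have hβnn : 0 ≤ β + μ₁ * μ₂' := by
    have hfac : lam ^ 2 - (μ₁ + μ₂') * lam + μ₁ * μ₂' = (lam - μ₁) * (lam - μ₂') := by ring
    rw [hβeq, hfac]
    by_cases hne : lam = μ₁
    · rw [hne, sub_self, zero_mul]
    · exact mul_nonneg (sub_nonneg.2 hlam1) (sub_nonneg.2 (hgap lam u huK hu0 hHu hne))
  -- the variational principle for `B` at the trial state `ψ`, expanded in the moments of `H`
  have hvar : β ≤ (star ψ ⬝ᵥ B *ᵥ ψ).re := by
    have h := minEnergyOn_mul_le_re_rayleigh hBH K hψK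
    rwa [hψ1, Complex.one_re, mul_one] at h
  have hexp : (star ψ ⬝ᵥ B *ᵥ ψ).re =
      (star ψ ⬝ᵥ (H * H) *ᵥ ψ).re - (μ₁ + μ₂') * (star ψ ⬝ᵥ H *ᵥ ψ).re := by
    rw [hBv ψ, mulVec_mulVec, dotProduct_sub, dotProduct_smul, Complex.sub_re, smul_eq_mul,
      Complex.re_ofReal_mul]
  rw [hexp] at hvar
  -- rearrange, using `(ψ, Hψ) < μ̌₂`
  have hden : 0 < μ₂' - (star ψ ⬝ᵥ H *ᵥ ψ).re := sub_pos.2 hlt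
  rw [sub_le_comm, le_div_iff₀ hden]
  nlinarith [hvar, hβnn, hden]

end Literature.MathematicalPhysics.QuantumChemistry

end
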